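import Literature.AlgebraicGeometry.Resolution.AlterationsMultisectionLocalStepProofs
import Literature.AlgebraicGeometry.Resolution.EtaleOverNhd
import Literature.AlgebraicGeometry.Resolution.EtaleAtOfFlatFiber
import Literature.AlgebraicGeometry.Resolution.FlatSliceAtPoint
import Literature.AlgebraicGeometry.Resolution.SmoothLocusBaseChange
import Literature.AlgebraicGeometry.Resolution.SmoothStalksRegular
import Literature.AlgebraicGeometry.Motives.FiberStalk
import Mathlib.AlgebraicGeometry.AlgClosed.Basic
import HarnessLib

/-!
# De Jong's alteration theorem: `f|_H` is étale near every point over `y` — a chart-level proof (Lemma 4.13)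

Topic: `Literature/AlgebraicGeometry/Resolution`. A second, chart-level route to the local
computation behind the named fact `DeJong1996MultisectionEtaleNhd`
(`AlterationsMultisectionLocalStep.lean`; discharged in `AlterationsMultisectionEtaleNhdProofs.lean`
via stalks), de Jong 1996, proof of Lemma 4.13:

> "At each of the intersection points `x ∈ f⁻¹(y) ∩ H` we have [`𝒪_{X,x}` smooth over
> `𝒪_{Y,y}`] since `f` is smooth at `x`. Further `H` is defined by `(h) ⊂ 𝒪_{X,x}` with
> `h̄ ∉ 𝔪²_{x,f⁻¹(y)}`, as `H ∩ f⁻¹(y)` [is reduced]. Therefore `f|_H : H → Y` is finite étale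
> over a neighbourhood of `y` in `Y`." (p. 70)

Main result: `exists_opens_etale_subschemeι_comp` — for every point `x̂ ∈ H = V(I)` over `y`
there is an open `O ∋ x̂` of `H` with `O ↪ H → Y` étale — assembled
from the ring-theoretic cores `flat_localization_quotient_span_singleton`
(`FlatSliceAtPoint.lean`, Matsumura's slicing criterion) and
`isEtaleAt_of_flat_of_isField_fiber` (`EtaleAtOfFlatFiber.lean`), the spreading lemma
`exists_etale_morphismRestrict_of_forall_exists_opens` (`EtaleOverNhd.lean`), and the
dictionary between the stalks of `X`, `H = V(I)`, their fibres over `y`, and the local rings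
of the affine charts (Mathlib `IsAffineOpen.arrowStalkMapIso`, `Scheme.arrowStalkMapSpecIso`;
`Literature.AlgebraicGeometry.Motives.nonempty_stalkFiber_ringEquiv`).

## Sources

* A. J. de Jong, *Smoothness, semi-stability and alterations*, Publ. Math. IHÉS 83 (1996),
  Lemma 4.13 (proof), p. 70. [DeJong1996]
-/

noncomputable section

open CategoryTheory CategoryTheory.Limits AlgebraicGeometry TopologicalSpace Topology IsLocalRing

namespace Literature.AlgebraicGeometry.Resolution

universe u

/-! ## Stalk maps through charts -/

/-- If `c : Z → H` induces an isomorphism on the stalk at `p` (e.g. an open immersion), the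
stalk map of `g : H → Y` at `c p` is isomorphic, as an arrow, to that of `c ≫ g` at `p`.
[folklore] -/
theorem nonempty_arrowIso_stalkMap_comp {Z H Y : Scheme.{u}} (c : Z ⟶ H) (g : H ⟶ Y) (p : Z)
    [IsOpenImmersion c] :
    Nonempty (Arrow.mk (g.stalkMap (c p)) ≅ Arrow.mk ((c ≫ g).stalkMap p)) := by
  let e : H.presheaf.stalk (c p) ≅ Z.presheaf.stalk p := asIso (c.stalkMap p)
  refine ⟨Arrow.isoMk (Iso.refl _) e ?_⟩
  simp only [e, Scheme.Hom.stalkMap_comp, Arrow.mk_hom, Iso.refl_hom, asIso_hom]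
  exact Category.id_comp _

/-- The stalk map at `p` of a morphism `Spec T → Y` of the form `Spec Φ ≫ (U ↪ Y)` for an affine
open `U` and `Φ : Γ(Y, U) → T` is isomorphic, as an arrow, to the localisation
`Γ(Y, U)_{Φ⁻¹𝔭} → T_𝔭` of `Φ`. [folklore] -/
theorem nonempty_arrowIso_stalkMap_of_eq_SpecMap_comp_fromSpec {Y : Scheme.{u}} {U : Y.Opens}
    (hU : IsAffineOpen U) {T : CommRingCat.{u}} (Φ : Γ(Y, U) ⟶ T) (E : Spec T ⟶ Y)
    (hE : E = Spec.map Φ ≫ hU.fromSpec) (p : Spec T) :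
    Nonempty (Arrow.mk (E.stalkMap p) ≅ Arrow.mk (CommRingCat.ofHom
      (Localization.localRingHom (p.asIdeal.comap Φ.hom) p.asIdeal Φ.hom rfl))) := by
  subst hE
  have e1 : Arrow.mk ((Spec.map Φ ≫ hU.fromSpec).stalkMap p) ≅
      Arrow.mk ((Spec.map Φ).stalkMap p) := by
    rw [Scheme.Hom.stalkMap_comp]
    let e : Y.presheaf.stalk (hU.fromSpec (Spec.map Φ p)) ≅
        (Spec Γ(Y, U)).presheaf.stalk (Spec.map Φ p) :=
      asIso (hU.fromSpec.stalkMap (Spec.map Φ p))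
    exact Arrow.isoMk e (Iso.refl _) (by
      simp only [e, Arrow.mk_hom, Iso.refl_hom, asIso_hom]
      exact (Category.comp_id _).symm)
  exact ⟨e1 ≪≫ Scheme.arrowStalkMapSpecIso Φ p⟩

/-- **The fibre ring of a stalk map through an affine chart.** Let `c : Spec T → H` induce an
isomorphism on the stalk at `p` with `c ≫ g = Spec Φ ≫ (U ↪ Y)`, `Φ : Γ(Y, U) → T`. Then
`𝒪_{H, c p} / 𝔪_{g(c p)} 𝒪_{H, c p} ≅ T_𝔓 / 𝔭 T_𝔓` for `𝔓` the prime of `p` and `𝔭 = Φ⁻¹𝔓`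
(the quotient by the extension of `𝔭 ⊆ Γ(Y, U)` along `Γ(Y, U) → T → T_𝔓`). [folklore] -/
theorem nonempty_stalkQuot_ringEquiv_of_chart {H Y : Scheme.{u}} {U : Y.Opens}
    (hU : IsAffineOpen U) {T : CommRingCat.{u}} (Φ : Γ(Y, U) ⟶ T) (c : Spec T ⟶ H) (g : H ⟶ Y)
    (p : Spec T) [IsOpenImmersion c] (hc : c ≫ g = Spec.map Φ ≫ hU.fromSpec) :
    Nonempty ((↑(H.presheaf.stalk (c p)) ⧸
        (maximalIdeal ↑(Y.presheaf.stalk (g (c p)))).map (g.stalkMap (c p)).hom) ≃+*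
      (Localization.AtPrime p.asIdeal ⧸ (p.asIdeal.comap Φ.hom).map
        ((algebraMap T (Localization.AtPrime p.asIdeal)).comp Φ.hom))) := by
  obtain ⟨e₁⟩ := nonempty_arrowIso_stalkMap_comp c g p
  obtain ⟨e₂⟩ := nonempty_arrowIso_stalkMap_of_eq_SpecMap_comp_fromSpec hU Φ (c ≫ g) hc p
  obtain ⟨e⟩ := Literature.AlgebraicGeometry.Motives.nonempty_fiberQuot_ringEquiv_of_arrowIso
    (e₁ ≪≫ e₂)
  refine ⟨e.trans (Ideal.quotEquivOfEq ?_)⟩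
  change (maximalIdeal (Localization.AtPrime (p.asIdeal.comap Φ.hom))).map
      (Localization.localRingHom (p.asIdeal.comap Φ.hom) p.asIdeal Φ.hom rfl) = _
  rw [← Localization.AtPrime.map_eq_maximalIdeal, Ideal.map_map]
  congr 1
  ext a
  simp [Localization.localRingHom_to_map]

/-! ## Local rings of the fibres -/

/-- A reduced Noetherian local ring of Krull dimension `0` is a field (it is Artinian, so its
maximal ideal is nilpotent, hence zero). [folklore] -/
theorem isField_of_isReduced_of_ringKrullDim_eq_zero (R : Type*) [CommRing R] [IsLocalRing R]
    [IsNoetherianRing R] [IsReduced R] (h : ringKrullDim R = 0) : IsField R := by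
  haveI : Ring.KrullDimLE 0 R := Ring.krullDimLE_iff.mpr h.le
  haveI : IsArtinianRing R :=
    isArtinianRing_iff_isNoetherianRing_krullDimLE_zero.mpr ⟨inferInstance, inferInstance⟩
  rw [IsLocalRing.isField_iff_maximalIdeal_eq]
  obtain ⟨n, hn⟩ := IsArtinianRing.isNilpotent_jacobson_bot (R := R)
  rw [IsLocalRing.jacobson_eq_maximalIdeal ⊥ bot_ne_top] at hn
  refine le_bot_iff.mp fun a ha => ?_
  have : IsNilpotent a := ⟨n, by
    have := Ideal.pow_mem_pow ha n
    rwa [hn, Ideal.zero_eq_bot, Ideal.mem_bot] at this⟩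
  exact this.eq_zero

/-- **The local rings of the fibre of a finite morphism with reduced fibre are fields.** If
`g : H → Y` is finite and the fibre `H_y` is reduced, then for every point `z` of `H_y` the local
ring `𝒪_{H_y, z}` is a field: `H_y` is finite and Jacobson, hence discrete, so `z` is maximal
for specialisation, `dim 𝒪_{H_y,z} = 0` (Stacks 02IZ), and a reduced zero-dimensional Noetherian
local ring is a field. [folklore] -/
theorem isField_stalk_fiber_of_isFinite {H Y : Scheme.{u}} (g : H ⟶ Y) [IsFinite g] (y : Y)
    [IsReduced (g.fiber y)] (z : ↥(g.fiber y)) : IsField ((g.fiber y).presheaf.stalk z) := by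
  haveI : Finite ↥(g.fiber y) := by
    haveI : Finite ↥(g ⁻¹' {y}) := (g.finite_preimage_singleton y).to_subtype
    exact Finite.of_equiv _ (g.fiberHomeo y).toEquiv.symm
  haveI : LocallyOfFiniteType (g.fiberToSpecResidueField y) :=
    MorphismProperty.pullback_snd _ _ inferInstance
  haveI : IsLocallyNoetherian (g.fiber y) :=
    LocallyOfFiniteType.isLocallyNoetherian (g.fiberToSpecResidueField y)
  have hmax : IsMax z := fun w hzw => by
    have : w = z := specializes_iff_eq.mp hzw
    rw [this]
  have h0 : ringKrullDim ((g.fiber y).presheaf.stalk z) = 0 := by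
    rw [ringKrullDim_stalk_eq_coheight, Order.coheight_eq_zero.mpr hmax]
    rfl
  exact isField_of_isReduced_of_ringKrullDim_eq_zero _ h0

/-- **The local ring of a fibre at a smooth point is a domain**: if `f` is smooth at `x`
(stalkwise formally smooth, `x ∈ sm(X/Y)`), then the point `x` of the fibre `X_{f x}` lies in the
smooth locus of `X_{f x} → Spec κ(f x)` (smooth locus and base change,
`Scheme.Hom.preimage_smoothLocus_le_smoothLocus_pullback_snd`), so has an open neighbourhood
smooth over the field `κ(f x)`, whose local rings are domains (Stacks 056S). [folklore] -/
theorem isDomain_stalk_fiber_of_mem_smoothLocus {X Y : Scheme.{u}} (f : X ⟶ Y)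
    [LocallyOfFinitePresentation f] {x : X} (hx : x ∈ f.smoothLocus) :
    IsDomain ((f.fiber (f x)).presheaf.stalk (f.asFiber x)) := by
  haveI : LocallyOfFinitePresentation (f.fiberToSpecResidueField (f x)) :=
    MorphismProperty.pullback_snd _ _ inferInstance
  have hx' : f.asFiber x ∈ (f.fiberToSpecResidueField (f x)).smoothLocus := by
    apply Scheme.Hom.preimage_smoothLocus_le_smoothLocus_pullback_snd f
      (Y.fromSpecResidueField (f x))
    show f.fiberι (f x) (f.asFiber x) ∈ f.smoothLocus
    rw [Scheme.Hom.fiberι_asFiber]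
    exact hx
  obtain ⟨V, hxV, hsm⟩ :=
    exists_smooth_ι_comp_of_mem_smoothLocus (f.fiberToSpecResidueField (f x)) hx'
  have hdom : IsDomain ((V : Scheme.{u}).presheaf.stalk ⟨f.asFiber x, hxV⟩) :=
    @isDomain_stalk_of_smooth _ _ _ (V.ι ≫ f.fiberToSpecResidueField (f x)) hsm ⟨f.asFiber x, hxV⟩
  obtain ⟨e⟩ := Literature.AlgebraicGeometry.Motives.nonempty_stalk_ringEquiv_of_isIso_stalkMap
    V.ι ⟨f.asFiber x, hxV⟩ (f.asFiber x) rfl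
  exact MulEquiv.isDomain _ e.toMulEquiv

/-- **The local ring of a fibre at a point of a finite part is not a field, if the fibre has
one-dimensional components.** For `f` locally of finite type with all irreducible components
of all fibres of dimension `1`, `H ⊆ X` closed with `H ∩ f⁻¹(y)` finite for all `y`, and
`x ∈ H`: the point `x` of `X_{f x}` is not maximal for specialisation
(`not_isMax_of_finite_closure`), so `dim 𝒪_{X_{f x}, x} ≥ 1` (Stacks 02IZ) and this local
ring is not a field. [folklore] -/
theorem not_isField_stalk_fiber {X Y : Scheme.{u}} (f : X ⟶ Y) [LocallyOfFiniteType f]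
    (hdim : ∀ (y : Y), ∀ C ∈ irreducibleComponents ↥(f.fiber y), topologicalKrullDim ↥C = 1)
    {H : Set X} (hH : IsClosed H) (hfin : ∀ y : Y, (H ∩ f ⁻¹' {y}).Finite) {x : X} (hxH : x ∈ H) :
    ¬ IsField ((f.fiber (f x)).presheaf.stalk (f.asFiber x)) := by
  intro hF
  have hξ' : f.fiberι (f x) (f.asFiber x) = x := f.fiberι_asFiber x
  have hmemy : ∀ z : ↥(f.fiber (f x)), f.fiberι (f x) z ∈ f ⁻¹' {f x} := fun z => by
    rw [← Scheme.Hom.range_fiberι]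
    exact ⟨z, rfl⟩
  have hS : (closure ({f.asFiber x} : Set ↥(f.fiber (f x)))).Finite := by
    have hcl : closure ({f.asFiber x} : Set ↥(f.fiber (f x))) ⊆ (f.fiberι (f x)) ⁻¹' H :=
      closure_minimal (Set.singleton_subset_iff.mpr (show f.fiberι (f x) (f.asFiber x) ∈ H by
        rw [hξ']; exact hxH)) (hH.preimage (f.fiberι (f x)).continuous)
    refine ((hfin (f x)).preimage (f.fiberι (f x)).isEmbedding.injective.injOn).subset ?_
    intro z hz
    exact ⟨hcl hz, hmemy z⟩
  have hnm := not_isMax_of_finite_closure (hdim (f x)) hS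
  have h0 : ringKrullDim ((f.fiber (f x)).presheaf.stalk (f.asFiber x)) = 0 :=
    ringKrullDim_eq_zero_of_isField hF
  rw [ringKrullDim_stalk_eq_coheight] at h0
  have hco : Order.coheight (f.asFiber x) = 0 := by exact_mod_cast h0
  exact hnm (Order.coheight_eq_zero.mp hco)

/-- In a Jacobson space, the points of a finite closed subset are closed points (closed points
are dense in every closed subset). [folklore] -/
theorem isClosed_singleton_of_mem_finite {α : Type*} [TopologicalSpace α] [JacobsonSpace α]
    {F : Set α} (hF : IsClosed F) (hfin : F.Finite) {x : α} (hx : x ∈ F) :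
    IsClosed ({x} : Set α) := by
  have h1 : closure (F ∩ closedPoints α) = F := by
    rw [JacobsonSpace.closure_inter_closedPoints_eq_closure hF.isLocallyClosed, hF.closure_eq]
  have h2 : IsClosed (F ∩ closedPoints α) := by
    rw [← Set.biUnion_of_singleton (F ∩ closedPoints α)]
    exact (hfin.inter_of_left _).isClosed_biUnion fun z hz => hz.2
  have h3 : x ∈ F ∩ closedPoints α := by
    rw [← h2.closure_eq, h1]
    exact hx
  exact h3.2

/-! ## Residue fields at closed points over an algebraically closed field -/

/-- **Residue fields over a closed point are all the ground field.** Let `k` be algebraically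
closed, `k → A → S` with `k → S` of finite type, `𝔔 ⊂ S` maximal over `𝔭 ⊂ A`. Then the residue
field extension `κ(𝔭) → κ(𝔔)` is surjective (`k → S/𝔔 = κ(𝔔)` is surjective by the
Nullstellensatz and algebraic closedness), in particular separable. [folklore] -/
theorem isSeparable_residueField_of_isAlgClosed {k A S : Type*} [Field k] [IsAlgClosed k]
    [CommRing A] [CommRing S] [Algebra A S] (ι : k →+* A)
    (hft : ((algebraMap A S).comp ι).FiniteType) (𝔭 : Ideal A) [𝔭.IsPrime] (𝔔 : Ideal S)
    [𝔔.IsMaximal] [𝔔.LiesOver 𝔭]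
    [Algebra (Localization.AtPrime 𝔭) (Localization.AtPrime 𝔔)]
    [Localization.AtPrime.IsLiesOverAlgebra 𝔭 𝔔] :
    Algebra.IsSeparable 𝔭.ResidueField 𝔔.ResidueField := by
  -- `k → S/𝔔` is surjective
  let θ : k →+* S ⧸ 𝔔 := (Ideal.Quotient.mk 𝔔).comp ((algebraMap A S).comp ι)
  have hθ : θ.FiniteType :=
    RingHom.FiniteType.comp (RingHom.FiniteType.of_surjective _ Ideal.Quotient.mk_surjective) hft
  have hθsurj : Function.Surjective θ := by
    letI : Field (S ⧸ 𝔔) := Ideal.Quotient.field 𝔔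
    letI : Algebra k (S ⧸ 𝔔) := θ.toAlgebra
    haveI : Algebra.FiniteType k (S ⧸ 𝔔) := hθ
    haveI : Module.Finite k (S ⧸ 𝔔) := finite_of_finite_type_of_isJacobsonRing k (S ⧸ 𝔔)
    exact (IsAlgClosed.algebraMap_bijective_of_isIntegral (k := k) (K := S ⧸ 𝔔)).2
  -- `S/𝔔 → κ(𝔔)` is surjective (`S/𝔔` is a field, `κ(𝔔)` its fraction field)
  have hfrac : Function.Surjective (algebraMap (S ⧸ 𝔔) 𝔔.ResidueField) := by
    have hfield : IsField (S ⧸ 𝔔) := (Ideal.Quotient.maximal_ideal_iff_isField_quotient 𝔔).mp ‹_›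
    let e := IsLocalization.atUnits (S ⧸ 𝔔) (nonZeroDivisors (S ⧸ 𝔔)) (S := 𝔔.ResidueField)
      (fun x hx => by
        letI : Field (S ⧸ 𝔔) := hfield.toField
        exact (mem_nonZeroDivisors_iff_ne_zero.mp hx).isUnit)
    intro z
    refine ⟨e.symm z, ?_⟩
    have h := e.commutes (e.symm z)
    rw [Algebra.algebraMap_self, RingHom.id_apply, AlgEquiv.apply_symm_apply] at h
    exact h.symm
  -- hence every element of `κ(𝔔)` comes from `k`, through `κ(𝔭)`
  refine ⟨fun z => ?_⟩
  obtain ⟨w, rfl⟩ := hfrac z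
  obtain ⟨a, rfl⟩ := hθsurj w
  have : algebraMap (S ⧸ 𝔔) 𝔔.ResidueField (θ a) =
      algebraMap 𝔭.ResidueField 𝔔.ResidueField (algebraMap A 𝔭.ResidueField (ι a)) := by
    rw [← IsScalarTower.algebraMap_apply A 𝔭.ResidueField 𝔔.ResidueField,
      IsScalarTower.algebraMap_apply A S 𝔔.ResidueField,
      IsScalarTower.algebraMap_apply S (S ⧸ 𝔔) 𝔔.ResidueField]
    rfl
  rw [this]
  exact isSeparable_algebraMap _

/-! ## The local step of the proof: `f|_H` is étale on a neighbourhood of every point over `y` -/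

/-- **de Jong 1996, proof of Lemma 4.13 — `f|_H` is étale on a neighbourhood in `H` of every
point `x̂ ∈ H` over the closed point `y`.** Setting: `k` algebraically closed, `X`, `Y` locally
Noetherian, `Y` locally of finite type over `k`, `f : X → Y` locally of finite presentation with
all irreducible components of all fibres of dimension `1`, `I` an effective Cartier divisor with
`H = V(I) → Y` finite, `H ∩ f⁻¹(y) ⊆ sm(X/Y)` and `H_y` reduced. On an affine chart
`W = Spec R ∋ x` of `X` over `U = Spec A ∋ y` with `I|_W = (h)`, the local ring of `S = R/(h)` at
the prime `𝔔` of `x̂` is flat over `A` (`flat_localization_quotient_span_singleton`: `f` is smooth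
at `x`, `𝒪_{X_y,x}` is a domain of dimension `≥ 1`, `𝒪_{H_y,x̂}` is a field) and then étale
(`isEtaleAt_of_flat_of_isField_fiber`, the residue fields being `k`), so `A → S_r` is étale for
some `r ∉ 𝔔`, and `Spec S_r ↪ H` is the sought neighbourhood.
[cite: DeJong1996, Lemma 4.13 (proof), p. 70] -/
theorem exists_opens_etale_subschemeι_comp {k : Type u} [Field k] [IsAlgClosed k]
    {X Y : Scheme.{u}} (f : X ⟶ Y) [LocallyOfFinitePresentation f] (gY : Y ⟶ Spec (.of k))
    [LocallyOfFiniteType gY] [IsLocallyNoetherian X] [IsLocallyNoetherian Y]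
    (hdim : ∀ (y : Y), ∀ C ∈ irreducibleComponents ↥(f.fiber y), topologicalKrullDim ↥C = 1)
    {I : X.IdealSheafData} (hI : IsEffectiveCartier I) [IsFinite (I.subschemeι ≫ f)]
    {y : Y} (hy : IsClosed ({y} : Set Y))
    (hsm : (I.support : Set X) ∩ f ⁻¹' {y} ⊆ f.smoothLocus)
    (hred : IsReduced ((I.subschemeι ≫ f).fiber y))
    (xh : I.subscheme) (hxh : (I.subschemeι ≫ f) xh = y) :
    ∃ O : I.subscheme.Opens, xh ∈ O ∧ Etale (O.ι ≫ I.subschemeι ≫ f) := by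
  have hfin : ∀ y' : Y, ((I.support : Set X) ∩ f ⁻¹' {y'}).Finite := fun y' => by
    refine (((I.subschemeι ≫ f).finite_preimage_singleton y').image I.subschemeι).subset ?_
    rintro x ⟨hxH, hxy⟩
    obtain ⟨z, rfl⟩ : x ∈ Set.range I.subschemeι := by
      rw [Scheme.IdealSheafData.range_subschemeι]
      exact hxH
    exact ⟨z, show (I.subschemeι ≫ f) z ∈ ({y'} : Set Y) by
      rw [Scheme.Hom.comp_apply]; exact hxy, rfl⟩
  -- affine open `U ∋ y` of `Y`
  obtain ⟨U, hU, hyU, -⟩ :=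
    exists_isAffineOpen_mem_and_subset (X := Y) (x := y) (U := ⊤) (Opens.mem_top _)
  -- Cartier chart at `x = ι x̂`, and an affine open `W ∋ x` inside it and `f⁻¹ U`
  have hfx : f (I.subschemeι xh) = y := by rw [← Scheme.Hom.comp_apply]; exact hxh
  obtain ⟨W₀, hxW₀, h₀, -, hIW₀⟩ := hI (I.subschemeι xh)
  obtain ⟨W, hW, hxW, hWle⟩ := exists_isAffineOpen_mem_and_subset (X := X) (x := I.subschemeι xh)
    (U := W₀.1 ⊓ f ⁻¹ᵁ U) ⟨hxW₀, show f (I.subschemeι xh) ∈ U by rw [hfx]; exact hyU⟩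
  have hWW₀ : W ≤ W₀.1 := fun z hz => (hWle hz).1
  have hWU : W ≤ f ⁻¹ᵁ U := fun z hz => (hWle hz).2
  -- the local equation `h` of `I` on `W`
  set h : Γ(X, W) := (X.presheaf.map (homOfLE hWW₀).op).hom h₀ with hhdef
  have hIW : I.ideal ⟨W, hW⟩ = Ideal.span {h} := by
    rw [← I.map_ideal (U := ⟨W, hW⟩) (V := W₀) hWW₀, hIW₀, Ideal.map_span, Set.image_singleton]
    rfl
  -- ring data: `A = Γ(Y, U) → R = Γ(X, W) → S = R/(h)`
  letI alg : Algebra Γ(Y, U) Γ(X, W) := (f.appLE U W hWU).hom.toAlgebra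
  let Φ : Γ(Y, U) ⟶ CommRingCat.of (Γ(X, W) ⧸ Ideal.span {h}) :=
    f.appLE U W hWU ≫ CommRingCat.ofHom (Ideal.Quotient.mk (Ideal.span {h}))
  -- the chart `c' : Spec S ↪ H = V(I)`
  let eIso : CommRingCat.of (Γ(X, W) ⧸ I.ideal ⟨W, hW⟩) ≅ CommRingCat.of (Γ(X, W) ⧸ Ideal.span {h}) :=
    (Ideal.quotEquivOfEq hIW).toCommRingCatIso
  let c' : Spec (CommRingCat.of (Γ(X, W) ⧸ Ideal.span {h})) ⟶ I.subscheme :=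
    Spec.map eIso.hom ≫ I.subschemeCover.f ⟨W, hW⟩
  have hmk : CommRingCat.ofHom (Ideal.Quotient.mk (I.ideal ⟨W, hW⟩)) ≫ eIso.hom =
      CommRingCat.ofHom (Ideal.Quotient.mk (Ideal.span {h})) := by
    ext b
    simp [eIso]
  have hcι : c' ≫ I.subschemeι =
      Spec.map (CommRingCat.ofHom (Ideal.Quotient.mk (Ideal.span {h}))) ≫ hW.fromSpec := by
    simp only [c', Category.assoc]
    erw [Scheme.IdealSheafData.subschemeCover_map_subschemeι, Scheme.IdealSheafData.glueDataObjι_ι]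
    rw [← Category.assoc, ← Spec.map_comp, hmk]
  have hc' : c' ≫ (I.subschemeι ≫ f) = Spec.map Φ ≫ hU.fromSpec := by
    rw [← Category.assoc, hcι, Category.assoc, ← IsAffineOpen.SpecMap_appLE_fromSpec f hU hW hWU,
      ← Category.assoc, ← Spec.map_comp]
  -- the point `p₁` of `Spec S` at `x̂`
  have hxhW : xh ∈ (I.subschemeCover.f ⟨W, hW⟩).opensRange := by
    rw [Scheme.IdealSheafData.opensRange_subschemeCover_map]
    exact hxW
  obtain ⟨p₀, hp₀⟩ := hxhW
  obtain ⟨p₁, rfl⟩ : ∃ p₁, c' p₁ = xh := ⟨Spec.map eIso.inv p₀, by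
    simp only [c', Scheme.Hom.comp_apply]
    rw [← Scheme.Hom.comp_apply _ (Spec.map eIso.hom), ← Spec.map_comp, Iso.hom_inv_id,
      Spec.map_id]
    exact hp₀⟩
  -- notation for the point `x`, the primes `𝔔 ⊂ S`, `𝔮 ⊂ R`, `𝔭 ⊂ A`
  have hxeq : I.subschemeι (c' p₁) =
      hW.fromSpec (Spec.map (CommRingCat.ofHom (Ideal.Quotient.mk (Ideal.span {h}))) p₁) := by
    show (c' ≫ I.subschemeι) p₁ = _
    rw [hcι]
    rfl
  set 𝔔 : Ideal (Γ(X, W) ⧸ Ideal.span {h}) := p₁.asIdeal with h𝔔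
  set 𝔮 : Ideal Γ(X, W) := 𝔔.comap (Ideal.Quotient.mk (Ideal.span {h})) with h𝔮
  haveI h𝔮p : 𝔮.IsPrime := by rw [h𝔮]; infer_instance
  set 𝔭 : Ideal Γ(Y, U) := 𝔔.under Γ(Y, U) with h𝔭
  -- (K1) the prime of `x` in `Γ(X, W)` is `𝔮`
  have hx𝔮 : hW.primeIdealOf ⟨I.subschemeι (c' p₁), hxW⟩ = ⟨𝔮, h𝔮p⟩ := by
    apply hW.fromSpec.isOpenEmbedding.injective
    rw [IsAffineOpen.fromSpec_primeIdealOf]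
    exact hxeq
  -- (K2') the prime of `f x = y` in `Γ(Y, U)` is `𝔭`
  have hy𝔭 : (hU.primeIdealOf ⟨f (I.subschemeι (c' p₁)), hWU hxW⟩).asIdeal = 𝔭 := by
    rw [← IsAffineOpen.comap_primeIdealOf_appLE U hU W hW hWU hxW, hx𝔮]
    show 𝔮.comap (f.appLE U W hWU).hom = 𝔔.comap (algebraMap Γ(Y, U) (Γ(X, W) ⧸ Ideal.span {h}))
    rw [h𝔮, Ideal.comap_comap]
    rfl
  -- (K5) `R` is smooth over `A` at `𝔮`
  have hxH : I.subschemeι (c' p₁) ∈ (I.support : Set X) := by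
    rw [← Scheme.IdealSheafData.range_subschemeι]
    exact ⟨_, rfl⟩
  have hxsm : I.subschemeι (c' p₁) ∈ f.smoothLocus := hsm ⟨hxH, hfx⟩
  haveI : IsOpenImmersion c' :=
    @IsOpenImmersion.comp _ _ _ (Spec.map eIso.hom) (I.subschemeCover.f ⟨W, hW⟩)
      inferInstance (I.subschemeCover.map_prop ⟨W, hW⟩)
  haveI hsmAt : Algebra.IsSmoothAt Γ(Y, U) 𝔮 := by
    have := (formallySmooth_stalkMap_iff U hU W hW hWU hxW).mp hxsm
    rw [hx𝔮] at this
    exact this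
  -- (K6) `𝔔` is maximal: `x̂` is a closed point of `H`
  haveI : JacobsonSpace I.subscheme :=
    LocallyOfFiniteType.jacobsonSpace ((I.subschemeι ≫ f) ≫ gY)
  have hxcl : IsClosed ({c' p₁} : Set I.subscheme) :=
    isClosed_singleton_of_mem_finite (hy.preimage (I.subschemeι ≫ f).continuous)
      ((I.subschemeι ≫ f).finite_preimage_singleton y) hxh
  haveI h𝔔max : 𝔔.IsMaximal := by
    rw [h𝔔, ← PrimeSpectrum.isClosed_singleton_iff_isMaximal]
    have hinj : Function.Injective c' := c'.isOpenEmbedding.injective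
    have hpre : c' ⁻¹' {c' p₁} = {p₁} := by
      ext q
      simp only [Set.mem_preimage, Set.mem_singleton_iff]
      exact hinj.eq_iff
    exact c'.isOpenEmbedding.isInducing.isClosed_iff.mpr ⟨{c' p₁}, hxcl, hpre⟩
  -- (K6') the residue field extension `κ(𝔭) ⊆ κ(𝔔)` is separable (both are `k`)
  have hΦalg : Φ.hom = algebraMap Γ(Y, U) (Γ(X, W) ⧸ Ideal.span {h}) := rfl
  let ιk : k →+* Γ(Y, U) :=
    (gY.appLE ⊤ U (fun _ _ => trivial)).hom.comp (Scheme.ΓSpecIso (.of k)).inv.hom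
  have hft : ((algebraMap Γ(Y, U) (Γ(X, W) ⧸ Ideal.span {h})).comp ιk).FiniteType := by
    have h1 : ((f ≫ gY).appLE ⊤ W (fun _ _ => trivial)).hom.FiniteType :=
      HasRingHomProperty.appLE @LocallyOfFiniteType (f ≫ gY) inferInstance
        ⟨⊤, isAffineOpen_top _⟩ ⟨W, hW⟩ _
    have h2 : (Scheme.ΓSpecIso (.of k)).inv.hom.FiniteType :=
      RingHom.FiniteType.of_surjective _ (Scheme.ΓSpecIso (.of k)).commRingCatIsoToRingEquiv.symm.surjective
    have h3 : (Ideal.Quotient.mk (Ideal.span {h})).FiniteType :=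
      RingHom.FiniteType.of_surjective _ Ideal.Quotient.mk_surjective
    have heq : (algebraMap Γ(Y, U) (Γ(X, W) ⧸ Ideal.span {h})).comp ιk =
        (Ideal.Quotient.mk (Ideal.span {h})).comp
          (((f ≫ gY).appLE ⊤ W (fun _ _ => trivial)).hom.comp (Scheme.ΓSpecIso (.of k)).inv.hom) := by
      rw [← hΦalg, ← Scheme.Hom.appLE_comp_appLE f gY ⊤ U W (fun _ _ => trivial) hWU]
      rfl
    rw [heq]
    exact RingHom.FiniteType.comp h3 (RingHom.FiniteType.comp h1 h2)
  letI := Localization.AtPrime.algebraOfLiesOver 𝔭 𝔔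
  haveI : Algebra.IsSeparable 𝔭.ResidueField 𝔔.ResidueField :=
    isSeparable_residueField_of_isAlgClosed ιk hft 𝔭 𝔔
  -- (K7) Noetherian and finite presentation
  haveI : IsNoetherianRing Γ(Y, U) := IsLocallyNoetherian.component_noetherian ⟨U, hU⟩
  haveI : IsNoetherianRing Γ(X, W) := IsLocallyNoetherian.component_noetherian ⟨W, hW⟩
  haveI : Algebra.FinitePresentation Γ(Y, U) Γ(X, W) := f.finitePresentation_appLE hU hW hWU
  haveI : Algebra.FinitePresentation Γ(Y, U) (Γ(X, W) ⧸ Ideal.span {h}) :=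
    Algebra.FinitePresentation.quotient ⟨{h}, by simp⟩
  -- (K4) the fibre `S_𝔔 / 𝔭 S_𝔔` is a field: it is `𝒪_{H_y, x̂}`
  have hfield : IsField (Localization.AtPrime 𝔔 ⧸
      𝔭.map (algebraMap Γ(Y, U) (Localization.AtPrime 𝔔))) := by
    haveI : IsReduced ((I.subschemeι ≫ f).fiber ((I.subschemeι ≫ f) (c' p₁))) := by
      rw [hxh]; exact hred
    have h1 := isField_stalk_fiber_of_isFinite (I.subschemeι ≫ f) ((I.subschemeι ≫ f) (c' p₁))
      ((I.subschemeι ≫ f).asFiber (c' p₁))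
    obtain ⟨e1⟩ := Literature.AlgebraicGeometry.Motives.nonempty_stalkFiber_ringEquiv_asFiber
      (I.subschemeι ≫ f) (c' p₁)
    obtain ⟨e2⟩ := nonempty_stalkQuot_ringEquiv_of_chart hU Φ c' (I.subschemeι ≫ f) p₁ hc'
    have h2 := MulEquiv.isField h1 e1.symm.toMulEquiv
    have h3 := MulEquiv.isField h2 e2.symm.toMulEquiv
    have hideal : (𝔔.comap Φ.hom).map
        ((algebraMap _ (Localization.AtPrime 𝔔)).comp Φ.hom) =
        𝔭.map (algebraMap Γ(Y, U) (Localization.AtPrime 𝔔)) := by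
      rw [hΦalg, ← IsScalarTower.algebraMap_eq]
    exact MulEquiv.isField h3 (Ideal.quotEquivOfEq hideal).symm.toMulEquiv
  -- (K3) the fibre `R_𝔮 / 𝔭 R_𝔮` is a domain and not a field: it is `𝒪_{X_y, x}`
  obtain ⟨e3⟩ : Nonempty (((f.fiber (f (I.subschemeι (c' p₁)))).presheaf.stalk
      (f.asFiber (I.subschemeι (c' p₁)))) ≃+*
        (Localization.AtPrime 𝔮 ⧸ 𝔭.map (algebraMap Γ(Y, U) (Localization.AtPrime 𝔮)))) := by
    obtain ⟨e1⟩ := Literature.AlgebraicGeometry.Motives.nonempty_stalkFiber_ringEquiv_asFiber f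
      (I.subschemeι (c' p₁))
    obtain ⟨e2⟩ := Literature.AlgebraicGeometry.Motives.nonempty_fiberQuot_ringEquiv_of_arrowIso
      (IsAffineOpen.arrowStalkMapIso f U hU W hW hWU hxW)
    have hmax := Literature.AlgebraicGeometry.Motives.map_localRingHom_maximalIdeal
      (R := Γ(Y, U)) (S := Γ(X, W))
      (p := hU.primeIdealOf ⟨f (I.subschemeι (c' p₁)), hWU hxW⟩)
      (q := hW.primeIdealOf ⟨I.subschemeι (c' p₁), hxW⟩)
      (congr($(IsAffineOpen.comap_primeIdealOf_appLE U hU W hW hWU hxW).1).symm)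
    have hx𝔮' : (hW.primeIdealOf ⟨I.subschemeι (c' p₁), hxW⟩).asIdeal = 𝔮 := by rw [hx𝔮]
    obtain ⟨e4⟩ := Literature.AlgebraicGeometry.Motives.nonempty_locQuot_ringEquiv_of_eq hx𝔮'
      ((hU.primeIdealOf ⟨f (I.subschemeι (c' p₁)), hWU hxW⟩).asIdeal.map
        (algebraMap Γ(Y, U) Γ(X, W)))
    have hideal : ((hU.primeIdealOf ⟨f (I.subschemeι (c' p₁)), hWU hxW⟩).asIdeal.map
        (algebraMap Γ(Y, U) Γ(X, W))).map (algebraMap Γ(X, W) (Localization.AtPrime 𝔮)) =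
        𝔭.map (algebraMap Γ(Y, U) (Localization.AtPrime 𝔮)) := by
      rw [hy𝔭, Ideal.map_map, ← IsScalarTower.algebraMap_eq]
    exact ⟨e1.trans (e2.trans ((Ideal.quotEquivOfEq hmax).trans (e4.trans
      (Ideal.quotEquivOfEq hideal))))⟩
  have hdom : IsDomain (Localization.AtPrime 𝔮 ⧸
      𝔭.map (algebraMap Γ(Y, U) (Localization.AtPrime 𝔮))) :=
    haveI := isDomain_stalk_fiber_of_mem_smoothLocus f hxsm
    MulEquiv.isDomain _ e3.symm.toMulEquiv
  have hnf : ¬ IsField (Localization.AtPrime 𝔮 ⧸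
      𝔭.map (algebraMap Γ(Y, U) (Localization.AtPrime 𝔮))) := fun hF =>
    not_isField_stalk_fiber f hdim I.support.isClosed hfin hxH (MulEquiv.isField hF e3.toMulEquiv)
  -- (K8) flatness and étaleness of `S` at `𝔔`
  have hflat : Module.Flat Γ(Y, U) (Localization.AtPrime 𝔔) :=
    flat_localization_quotient_span_singleton h 𝔭 𝔔 hdom hnf hfield
  haveI het : Algebra.IsEtaleAt Γ(Y, U) 𝔔 :=
    isEtaleAt_of_flat_of_isField_fiber 𝔭 𝔔 hflat hfield
  obtain ⟨r, hr𝔔, hret⟩ := Algebra.exists_etale_of_isEtaleAt (R := Γ(Y, U)) 𝔔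
  -- (K9) the open piece `Spec S_r ↪ H`, étale over `Y`
  haveI := hret
  let j : Spec (CommRingCat.of (Localization.Away r)) ⟶ I.subscheme :=
    Spec.map (CommRingCat.ofHom (algebraMap (Γ(X, W) ⧸ Ideal.span {h}) (Localization.Away r))) ≫ c'
  haveI : IsOpenImmersion j :=
    @IsOpenImmersion.comp _ _ _ _ c' inferInstance inferInstance
  have hjg : j ≫ (I.subschemeι ≫ f) = Spec.map (Φ ≫ CommRingCat.ofHom
      (algebraMap (Γ(X, W) ⧸ Ideal.span {h}) (Localization.Away r))) ≫ hU.fromSpec := by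
    simp only [j, Category.assoc]
    rw [hc', ← Category.assoc, ← Spec.map_comp]
  haveI : Etale (j ≫ (I.subschemeι ≫ f)) := by
    rw [hjg]
    haveI : Etale (Spec.map (Φ ≫ CommRingCat.ofHom
        (algebraMap (Γ(X, W) ⧸ Ideal.span {h}) (Localization.Away r)))) := by
      rw [HasRingHomProperty.Spec_iff (P := @Etale)]
      show RingHom.Etale ((algebraMap (Γ(X, W) ⧸ Ideal.span {h}) (Localization.Away r)).comp Φ.hom)
      rw [hΦalg, ← IsScalarTower.algebraMap_eq]
      exact RingHom.etale_algebraMap.mpr hret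
    infer_instance
  refine ⟨j.opensRange, ?_, IsGenericallyEtale.etale_opensRange_ι_comp j (I.subschemeι ≫ f)⟩
  -- `x̂ = c' p₁` lies in the image of `Spec S_r`, as `r ∉ 𝔔`
  have hp₁ : p₁ ∈ Set.range (PrimeSpectrum.comap
      (algebraMap (Γ(X, W) ⧸ Ideal.span {h}) (Localization.Away r))) := by
    rw [PrimeSpectrum.localization_away_comap_range (Localization.Away r) r]
    exact hr𝔔
  obtain ⟨q, hq⟩ := hp₁
  refine ⟨q, ?_⟩
  show (Spec.map (CommRingCat.ofHom (algebraMap (Γ(X, W) ⧸ Ideal.span {h})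
    (Localization.Away r))) ≫ c') q = c' p₁
  rw [Scheme.Hom.comp_apply, ← hq]
  rfl

end Literature.AlgebraicGeometry.Resolution

end
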